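import Summits.QuantumFields.YangMills.Theorems.BalabanUVNodesN07SchemeTokOfRecordTwoSmall
import HarnessLib

/-!
# NODE N07 — SECT. C's REGIME AT THE RECORD «IN THE SMALL»: at a guarded background the letters `H♭ := H1OfRecordAtBgFlat` (bounded, `b := ‖H♭‖`) and `C^{𝔰𝔩} := CslOfRecord` (analytic at `0`,
# `C^{𝔰𝔩}(0) = 0`, `DC^{𝔰𝔩}(0) = 0` — ✓`analyticAt_CslOfRecord_zero`, ✓`CslOfRecord_zero`, ✓`c1Tok_of_smallBelow`) carry `Prop4Hyp C^{𝔰𝔩} C₂ c₄` for SOME `C₂, c₄ > 0` (Taylor) and lit's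
# `Regime H♭ 0 C^{𝔰𝔩} b 0 C₂ c₄ 0 a_C ε_C` for ALL small radii `a_C ≤ ε_C ≤ t₀`; hence the `N = 2` reduction «`RegimeTok ⟹ SchemeTokOfRecord`» of ✓p825707 with NO Sect. C row displayed —
# only «Sect. C's radii small: `0 < a₃ ≤ ε_C ≤ t₀(U₀)`» ([15] (44) p. 285, (51)–(54) p. 285, Prop. 3 p. 289, Prop. 4 p. 292, Prop. 6 p. 295; [B9] (3.134))

Cell `pub-ymgap`, width seat `pub-ymgap-dag-n07-w3` (g27), CLAIM-12.  `--kind proof --supports stmt-QuantumFields-27238 --as helper`; count-neutral.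
[15] = [Balaban1985Variational]; [B9] = [Balaban1985BackgroundPropagators].

WHAT THIS IS ∕ IS NOT.  The constants `b, C₂, c₄, t₀` are EXISTENTIAL and depend on the background, the lattice data and the level (finite dimension + analyticity at one point); they are NOT
Bałaban's uniform constants (Props 3–4: `O(1)`, `L`-independent), which the continuum programme needs and which stay the business of the K0∕Node O lanes.  For def-Y's scheme tokens at ONE
finite torus the existential constants suffice — the (R-Sch) package quantifies its scheme data existentially per volume.
* §1 (generic, real normed spaces) `exists_sq_bound_of_contDiffAt_two` — `C²` at `0`, `Φ 0 = 0`, `DΦ(0) = 0` ⟹ `‖Φ y‖ ≤ C‖y‖²` on a ball.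
* §2 ★`exists_prop4Hyp_cslOfRecord` — `∃ C₂ ≥ 0, c₄ > 0, Prop4Hyp C^{𝔰𝔩} C₂ c₄` (guard; any `N`).
* §3 ★★★`exists_sectCRegime_ofRecord` — `∃ b C₂ c₄ t₀`, `Prop4Hyp C^{𝔰𝔩} C₂ c₄ ∧ ∀ 0 < a_C ≤ ε_C ≤ t₀, Regime H♭ 0 C^{𝔰𝔩} b 0 C₂ c₄ 0 a_C ε_C` (guard; any `N`).
* §4 ★★★★`schemeTokOfRecord_two_of_regimeTok_smallRadii` — `N = 2`: `∃ t₀ > 0` such that for all scheme data with `0 < a₃ ≤ ε_C ≤ t₀`: guard + `G′` real ∧ `S`-commuting + `Delta2Tok ∧ Delta2SymmTok`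
  + domain (20)-smallness + `RegimeTok` ⟹ `SchemeTokOfRecord` (✓`schemeTokOfRecord_two_of_regimeTok_of_small` with `a_C := ε_C` and the Sect. C rows from §3).

HONEST LABELS.  Existential, non-uniform constants; `RegimeTok` (Prop. 6 (117)–(121) with [B9] Thm 3.13's `B₀`), the `G′` row, the domain smallness and the guard stay DISPLAYED; `N = 2` in §4.
Count-neutral; N07 NOT discharged; K0ᴬ NOT closed; P0 ⟨26900⟩ OPEN; R4 is the conditional finite-𝕋⁴ rung only.  Nothing here is a claim about the Yang–Mills mass gap (`Summit.QuantumFields`):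
finite torus, fixed `ε`; nothing continuum ∕ OS ∕ Clay.
-/

set_option autoImplicit false

noncomputable section

open Filter Metric Topology
open scoped Matrix Matrix.Norms.L2Operator InnerProductSpace ComplexConjugate

namespace Summit.QuantumFields.YangMills.Theorems.N07SectCRegimeOfRecordSmall

open Literature.MathematicalPhysics.QuantumFieldTheory.Balaban1983to89
open Literature.MathematicalPhysics.QuantumFieldTheory.Balaban1983to89.T4Continuum (T4Family)
open T4Continuum BlockAveraging
open B9Eq311TracePairing (starW)
open B11Eq103H1Complex (SiteL2K BondL2K)
open B11Eq111FrakG (nabla115)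
open B11Eq115Space (NegSize NegSup levWeight JetSup)
open B11Eq174Chart (Regime)
open B11Prop6Scheme (Prop4Hyp)
open Node00
open Summit.QuantumFields.YangMills.Theorems.N07TraceSectorDefs (scalPartW)
open Summit.QuantumFields.YangMills.Theorems.N07SchemeTokensOfRecord (c1Tok_of_smallBelow)
open Summit.QuantumFields.YangMills.Theorems.N07SchemeTokOfRecordTwoSmall (schemeTokOfRecord_two_of_regimeTok_of_small)

/-! ## §1  A quadratic bound from `C²` at a point -/

section Generic

variable {E G : Type*} [NormedAddCommGroup E] [NormedSpace ℝ E] [NormedAddCommGroup G] [NormedSpace ℝ G]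

/-- **SECOND-ORDER VANISHING AT THE ORIGIN, LOCAL FORM**: a map `Φ` of class `C²` at `0` (real sense) with `Φ 0 = 0` and `DΦ(0) = 0` satisfies `‖Φ y‖ ≤ C‖y‖²` on a ball `‖y‖ < r`
(`DΦ` Lipschitz near `0`, mean value inequality on the ball of radius `‖y‖`). [folklore] [cite: Balaban1985Variational, (44) p.285 (the shape «|C(A′)| ≤ C₂|A′|²»)] -/
theorem exists_sq_bound_of_contDiffAt_two {Φ : E → G} (hΦ : ContDiffAt ℝ 2 Φ 0) (h0 : Φ 0 = 0) (hD0 : fderiv ℝ Φ 0 = 0) :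
    ∃ C r : ℝ, 0 ≤ C ∧ 0 < r ∧ ∀ y : E, ‖y‖ < r → ‖Φ y‖ ≤ C * ‖y‖ ^ 2 := by
  -- `DΦ` is `C¹` at `0`, hence Lipschitz on a neighbourhood; `Φ` is differentiable on a neighbourhood
  have hD : ContDiffAt ℝ 1 (fderiv ℝ Φ) 0 := hΦ.fderiv_right (m := 1) (by norm_num)
  obtain ⟨K, t, ht, hK⟩ := hD.exists_lipschitzOnWith
  have hdiff : ∀ᶠ y in 𝓝 (0 : E), DifferentiableAt ℝ Φ y :=
    (hΦ.eventually (by simp)).mono fun y hy => hy.differentiableAt (by simp)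
  obtain ⟨r₁, hr₁, hr₁t⟩ := Metric.mem_nhds_iff.1 ht
  obtain ⟨r₂, hr₂, hr₂d⟩ := Metric.eventually_nhds_iff.1 hdiff
  have hrpos : 0 < min r₁ r₂ := lt_min hr₁ hr₂
  have hmem_t : ∀ z : E, ‖z‖ < min r₁ r₂ → z ∈ t := fun z hz => hr₁t (mem_ball_zero_iff.2 (hz.trans_le (min_le_left _ _)))
  have hmem_d : ∀ z : E, ‖z‖ < min r₁ r₂ → DifferentiableAt ℝ Φ z := fun z hz =>
    hr₂d (by rw [dist_zero_right]; exact hz.trans_le (min_le_right _ _))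
  refine ⟨K, min r₁ r₂, K.2, hrpos, fun y hy => ?_⟩
  -- Lipschitz estimate for `DΦ` between `0` and `z`
  have hbound : ∀ z ∈ closedBall (0 : E) ‖y‖, ‖fderiv ℝ Φ z‖ ≤ K * ‖y‖ := by
    intro z hz
    have hz' : ‖z‖ ≤ ‖y‖ := mem_closedBall_zero_iff.1 hz
    have h := hK.norm_sub_le (hmem_t z (hz'.trans_lt hy)) (hmem_t 0 (by rw [norm_zero]; exact hrpos))
    rw [hD0, sub_zero, sub_zero] at h
    exact h.trans (mul_le_mul_of_nonneg_left hz' K.2)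
  have h := (convex_closedBall (0 : E) ‖y‖).norm_image_sub_le_of_norm_fderiv_le (f := Φ)
    (fun z hz => hmem_d z ((mem_closedBall_zero_iff.1 hz).trans_lt hy)) hbound (mem_closedBall_self (norm_nonneg y)) (mem_closedBall_zero_iff.2 le_rfl)
  rw [h0, sub_zero, sub_zero] at h
  calc ‖Φ y‖ ≤ K * ‖y‖ * ‖y‖ := h
    _ = K * ‖y‖ ^ 2 := by ring

end Generic

/-! ## §2–§3  `Prop4Hyp` and the Sect. C regime at the record, existential constants -/

section Record

variable (F : T4Family) (N : ℕ) [NeZero N] (K : ℕ) (k : ℕ) (Ω : ℕ → Set (Site (F.P K) 0)) (U₀ : GaugeField (F.P K) 0 (SU N))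
  [Fact (0 < (F.L : ℝ))] [Fact (0 < (F.P K).eta k)] [Fact (0 < c0Rec F K k)] [Fact (∀ c, 0 < wBRec F K k c)]
  (levB : PBond (F.P K) k → ℕ) (a : ℝ)
  (hposb : ∀ x, x ≠ 0 → 0 < RCLike.re ⟪x, laplaceAOfRecord F N k U₀ (QOfRecord F N k U₀) (QflatOfRecord F N k) a x⟫_ℂ)
  (hQ : Function.Surjective (QOfRecord F N k U₀))

omit [Fact (0 < c0Rec F K k)] [Fact (∀ c, 0 < wBRec F K k c)] in
/-- ★ **`Prop4Hyp C^{𝔰𝔩} C₂ c₄` FOR SOME `C₂ ≥ 0`, `c₄ > 0`** at a guarded background: `C^{𝔰𝔩}` is analytic at `0` (✓`analyticAt_CslOfRecord_zero`) with `C^{𝔰𝔩}(0) = 0` (✓`CslOfRecord_zero`) and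
`DC^{𝔰𝔩}(0) = 0` (✓`c1Tok_of_smallBelow`), so §1 applies. [cite: Balaban1985Variational, (44) p.285, Prop. 4 p.292, (56) p.286] -/
theorem exists_prop4Hyp_cslOfRecord (hU₀ : SmallBelow (avOfRecord F N K) k U₀) :
    ∃ C₂ c₄ : ℝ, 0 ≤ C₂ ∧ 0 < c₄ ∧ Prop4Hyp (CslOfRecord F N K k Ω U₀ levB) C₂ c₄ := by
  have han : AnalyticAt ℂ (CslOfRecord F N K k Ω U₀ levB) 0 := analyticAt_CslOfRecord_zero F N K k Ω U₀ levB hU₀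
  have hanR : ContDiffAt ℝ 2 (CslOfRecord F N K k Ω U₀ levB) 0 := han.contDiffAt.restrict_scalars ℝ
  have h0 : CslOfRecord F N K k Ω U₀ levB 0 = 0 := CslOfRecord_zero F N K k Ω U₀ levB hU₀
  have hD0 : fderiv ℝ (CslOfRecord F N K k Ω U₀ levB) 0 = 0 := by
    rw [((c1Tok_of_smallBelow F N K k Ω U₀ levB hU₀).restrictScalars ℝ).fderiv, ContinuousLinearMap.restrictScalars_zero]
  obtain ⟨C, r, hC, hr, hq⟩ := exists_sq_bound_of_contDiffAt_two hanR h0 hD0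
  -- ℂ-differentiability on a ball around `0`
  obtain ⟨r', hr', hd⟩ := Metric.eventually_nhds_iff.1 han.eventually_analyticAt
  refine ⟨C, min r r', hC, lt_min hr hr', ⟨fun Y hY => hq Y (hY.trans_le (min_le_left _ _)), fun Y hY => ?_⟩⟩
  have hY' : dist Y 0 < r' := by rw [dist_zero_right]; exact (show ‖Y‖ < min r r' from hY).trans_le (min_le_right _ _)
  exact (hd hY').differentiableAt.differentiableWithinAt

/-- ★★★ **SECT. C's REGIME AT THE RECORD FOR ALL SMALL RADII**: at a guarded background there are `b, C₂ ≥ 0`, `c₄, t₀ > 0` with `Prop4Hyp C^{𝔰𝔩} C₂ c₄` and, for every `0 < a_C ≤ ε_C ≤ t₀`, lit's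
`Regime H♭ 0 C^{𝔰𝔩} b 0 C₂ c₄ 0 a_C ε_C` (`b = ‖H♭‖`; the conditions (52)–(54)∕(118)–(121) `2(ε_C + a_C) ≤ c₄`, `bC₂(ε_C + a_C)² ≤ ε_C`, `4bC₂(ε_C + a_C) < 1` hold once `4ε_C ≤ c₄` and `8bC₂ε_C < 1`).
EXISTENTIAL, NON-UNIFORM constants. [cite: Balaban1985Variational, (51)–(54) p.285, Prop. 3 p.289, Prop. 4 p.292, (117)–(121) p.295] -/
theorem exists_sectCRegime_ofRecord (hU₀ : SmallBelow (avOfRecord F N K) k U₀) :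
    ∃ b C₂ c₄ t₀ : ℝ, 0 ≤ b ∧ 0 ≤ C₂ ∧ 0 < c₄ ∧ 0 < t₀ ∧ Prop4Hyp (CslOfRecord F N K k Ω U₀ levB) C₂ c₄ ∧
      ∀ εC aC : ℝ, 0 < aC → aC ≤ εC → εC ≤ t₀ →
        Regime (H1OfRecordAtBgFlat F N K k Ω U₀ levB a hposb hQ) 0 (CslOfRecord F N K k Ω U₀ levB) b 0 C₂ c₄ 0 aC εC := by
  obtain ⟨C₂, c₄, hC₂, hc₄, hP⟩ := exists_prop4Hyp_cslOfRecord F N K k Ω U₀ levB hU₀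
  set b : ℝ := ‖H1OfRecordAtBgFlat F N K k Ω U₀ levB a hposb hQ‖ with hb
  have hb0 : 0 ≤ b := by rw [hb]; exact norm_nonneg (H1OfRecordAtBgFlat F N K k Ω U₀ levB a hposb hQ)
  have hbC : 0 ≤ b * C₂ := mul_nonneg hb0 hC₂
  -- the radius threshold
  set t₀ : ℝ := min (c₄ / 4) (1 / (8 * (b * C₂) + 1)) with ht₀
  have hden : 0 < 8 * (b * C₂) + 1 := by positivity
  have ht₀pos : 0 < t₀ := lt_min (by positivity) (by positivity)
  refine ⟨b, C₂, c₄, t₀, hb0, hC₂, hc₄, ht₀pos, hP, fun εC aC haC hle hε => ?_⟩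
  have hεpos : 0 < εC := haC.trans_le hle
  have hsum : εC + aC ≤ 2 * εC := by linarith
  have h4 : 4 * εC ≤ c₄ := by
    have := hε.trans (min_le_left _ _)
    linarith
  have h8 : 8 * (b * C₂) * εC < 1 := by
    have h1 : εC ≤ 1 / (8 * (b * C₂) + 1) := hε.trans (min_le_right _ _)
    have h2 : 8 * (b * C₂) * εC ≤ 8 * (b * C₂) * (1 / (8 * (b * C₂) + 1)) := mul_le_mul_of_nonneg_left h1 (by positivity)
    have h3 : 8 * (b * C₂) * (1 / (8 * (b * C₂) + 1)) < 1 := by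
      rw [mul_one_div, div_lt_one hden]
      linarith
    exact h2.trans_lt h3
  refine
    { norm_G := fun f => (H1OfRecordAtBgFlat F N K k Ω U₀ levB a hposb hQ).le_opNorm f
      norm_L := fun Y => by simp
      quad := hP.quadAnalytic
      B₀_nonneg := hb0
      C₄_nonneg := hC₂
      θ_nonneg := le_rfl
      ε₄_nonneg := hεpos.le
      dom := by linarith
      self := ?_
      contr := ?_ }
  · -- `b·0 + 0·(εC + aC) + bC₂(εC + aC)² ≤ εC`
    have hsq : (εC + aC) ^ 2 ≤ (2 * εC) ^ 2 := by
      have h1 : 0 ≤ εC + aC := by linarith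
      nlinarith
    have h1 : b * C₂ * (εC + aC) ^ 2 ≤ b * C₂ * (2 * εC) ^ 2 := mul_le_mul_of_nonneg_left hsq hbC
    have h2 : b * C₂ * (2 * εC) ^ 2 = (4 * (b * C₂) * εC) * εC := by ring
    have h3 : 4 * (b * C₂) * εC ≤ 1 := by nlinarith
    have h4' : (4 * (b * C₂) * εC) * εC ≤ 1 * εC := mul_le_mul_of_nonneg_right h3 hεpos.le
    nlinarith
  · -- `0 + 4bC₂(εC + aC) < 1`
    have h1 : 4 * b * C₂ * (εC + aC) ≤ 4 * b * C₂ * (2 * εC) := by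
      have : 0 ≤ 4 * b * C₂ := by positivity
      exact mul_le_mul_of_nonneg_left hsum this
    nlinarith

end Record

/-! ## §4  The `N = 2` reduction with Sect. C's rows discharged in the small -/

section Two

variable (F : T4Family) (K : ℕ) (k : ℕ) (Ω : ℕ → Set (Site (F.P K) 0)) (U₀ : GaugeField (F.P K) 0 (SU 2))
  [Fact (0 < (F.L : ℝ))] [Fact (0 < (F.P K).eta k)] [Fact (0 < c0Rec F K k)] [Fact (∀ c, 0 < wBRec F K k c)] (levB : PBond (F.P K) k → ℕ) (a : ℝ)
  (hposb : ∀ x, x ≠ 0 → 0 < RCLike.re ⟪x, laplaceAOfRecord F 2 k U₀ (QOfRecord F 2 k U₀) (QflatOfRecord F 2 k) a x⟫_ℂ)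
  (hQ : Function.Surjective (QOfRecord F 2 k U₀))

set_option maxHeartbeats 1600000 in
/-- ★★★★ **`RegimeTok ⟹ SchemeTokOfRecord` AT `N = 2` WITH NO SECT. C ROW DISPLAYED**: at a guarded background there is `t₀ > 0` such that for every scheme datum (`dom`, `G′` real and `S`-commuting,
the (3.134) `Δ2`, the slot-(c) positivity, the constants) whose Sect. C radius and Prop. 6 radius satisfy `0 < a₃ ≤ ε_C ≤ t₀`, the domain (20)-smallness and Prop. 6's `RegimeTok` give def-Y's bundle
`SchemeTokOfRecord` (Sect. C's `Regime`∕`Prop4Hyp` from §3 with `a_C := ε_C`, `hCreal`∕`hCtr` from ✓`exists_radius_cslRows`). [cite: Balaban1985Variational, Prop. 6 (115)–(121) p.295, (51)–(54) p.285, Prop. 4 p.292; Balaban1985BackgroundPropagators, (3.134) p.422] -/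
theorem schemeTokOfRecord_two_of_regimeTok_smallRadii (h : SmallBelow (avOfRecord F 2 K) k U₀) :
    ∃ t₀ > 0, ∀ (dom : Set (GaugeField (F.P K) k (SU 2)))
      (Gp : SiteL2K ℂ (F.P K).d (fun _ => (F.P K).sitesPerDir 0) (c0Rec F K k) (WRec 2) →ₗ[ℂ]
        SiteL2K ℂ (F.P K).d (fun _ => (F.P K).sitesPerDir 0) (c0Rec F K k) (WRec 2))
      (Δ2 : BondL2K ℂ (F.P K).d (fun _ => (F.P K).sitesPerDir 0) (c0Rec F K k) (WRec 2) →ₗ[ℂ]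
        BondL2K ℂ (F.P K).d (fun _ => (F.P K).sitesPerDir 0) (c0Rec F K k) (WRec 2))
      (hposπ : ∀ x, x ≠ 0 → 0 < RCLike.re ⟪x, laplaceAOfRecordAt F 2 k U₀ (hessOpOfRecord128 F 2 k U₀ Gp (QflatOfRecord F 2 k) Δ2)
        (QOfRecord F 2 k U₀) (QflatOfRecord F 2 k) a x⟫_ℂ) (εC B₀ C₄ a₃ j a𝔄 ε₄ : ℝ),
      0 < a₃ → a₃ ≤ εC → εC ≤ t₀ →
      (∀ s, Gp (starW (phiRec 2) s) = starW (phiRec 2) (Gp s)) → (∀ s, Gp (scalPartW 2 _ s) = scalPartW 2 _ (Gp s)) →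
      Delta2Tok F 2 K k Ω U₀ levB a hposb hQ Δ2 → Delta2SymmTok F 2 K k Ω U₀ Δ2 →
      (∀ V ∈ dom, ∀ c, ‖(V c : Matrix (Fin 2) (Fin 2) ℂ) * star (Averaging.iter (avOfRecord F 2 K) k U₀ c : Matrix (Fin 2) (Fin 2) ℂ) - 1‖ ≤ 1 / 4) →
      (bgSchemeOfRecord F 2 K k Ω U₀ dom levB Gp Δ2 a hposπ hposb hQ εC B₀ C₄ a₃ j a𝔄 ε₄).RegimeTok →
      SchemeTokOfRecord F 2 K k Ω U₀ dom levB Gp Δ2 a hposπ hposb hQ εC B₀ C₄ a₃ j a𝔄 ε₄ := by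
  obtain ⟨r, hr, hsmall⟩ := schemeTokOfRecord_two_of_regimeTok_of_small F K k Ω U₀ levB h
  obtain ⟨b, C₂, c₄, t₁, -, -, -, ht₁, hP, hReg⟩ := exists_sectCRegime_ofRecord F 2 K k Ω U₀ levB a hposb hQ h
  refine ⟨min t₁ (r / 4), lt_min ht₁ (by positivity), fun dom Gp Δ2 hposπ εC B₀ C₄ a₃ j a𝔄 ε₄ ha₃ ha₃ε hεt hGpR hGpS hΔ hs hdom hR => ?_⟩
  have hεt₁ : εC ≤ t₁ := hεt.trans (min_le_left _ _)
  have hεr : εC + εC < r := by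
    have := hεt.trans (min_le_right _ _)
    linarith
  have hεpos : 0 < εC := ha₃.trans_le ha₃ε
  exact hsmall dom Gp Δ2 a hposπ hposb hQ εC B₀ C₄ a₃ j a𝔄 ε₄ b C₂ c₄ εC (hReg εC εC hεpos le_rfl hεt₁) hP ha₃ε hεr hGpR hGpS hΔ hs hdom hR

end Two

end Summit.QuantumFields.YangMills.Theorems.N07SectCRegimeOfRecordSmall

end
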